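import Mathlib
import Literature.Computability.AlgebraicComplexity.MS21SigmaPiSigmaCoefficientMap
import Literature.Computability.AlgebraicComplexity.MS21SigmaPiOrbitsProofs
import HarnessLib

/-!
# Medini–Shpilka 2021, towards Cor 44 as typed: hitting sets for `(s-sparse, deg ≤ d)∘affine` on a
# grid, by the `ΣΠΣ` coefficient cover

Sequel of `MS21SigmaPiSigmaCoefficientMap.lean` (brick: `MS2021.SPSCoeff.exists_hittingSet_isSPS`)
and `MS21SigmaPiOrbitsProofs.lean` (`MS2021.isSPS_aeval_affine`: `g(Ax+b) ∈ Σ^{[s]}Π^{[d+1]}Σ` for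
`s`-sparse `g` of degree `≤ d`). Combining the two:

* `MS2021.SPSCoeff.isSPS_of_mem_sparseAffOrbits` — every `f ∈ sparseAffOrbits n s d` is computed by a
  `Σ^{[s]}Π^{[d+1]}Σ` circuit and has degree `≤ d`;
* `MS2021.SPSCoeff.exists_hittingSet_sparseAffOrbits_grid` — for a nonempty grid `S ⊆ F` with
  `|S| ≥ 2d` some `H ⊆ Sⁿ` with `|H| ≤ s·((d+1)·(n+1))·(log₂(|S|ⁿ·(d+1) + 1) + 1) + 1` is a hitting
  set for `sparseAffOrbits n s d` (`HittingSets.IsHittingSetFor`).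

What remains for the named fact `MS2021_cor_44` (existence and size `(n·d)^{c(⌊log₂ s⌋+1)} + c`, NOT
discharged here): choosing the grid from `|F| > n·d` (`n ≥ 2`), the corner cases `n ≤ 1` / `d = 0`,
and the size arithmetic. `VP ≠ VNP` is NOT proved and nothing here bears on it.

## References
* [MediniShpilka2021] D. Medini, A. Shpilka, CCC 2021, LIPIcs 200:19, Def 4, §1.2.3 and Cor 44
  (p.19:6, 19:13-14; = arXiv Def 1.4 / Cor 1.27).
* J. Heintz, C.-P. Schnorr, STOC 1980, Thm 4.4 (coefficient-cover engine).
-/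

noncomputable section

open MvPolynomial

namespace Literature.Computability.AlgebraicComplexity

open HittingSets

namespace MS2021

namespace SPSCoeff

variable {K : Type*} [Field K]

/-- Members of `sparseAffOrbits n s d` are `Σ^{[s]}Π^{[d+1]}Σ` circuits of degree `≤ d`.
[cite: MediniShpilka2021, §1.2.3 "(Σ^{[s]}Π^{[d]})^{GLaff} ⊂ Σ^{[s]}Π^{[d+1]}Σ-ish inclusion" (CCC p.19:13; arXiv p0008:L55)] -/
theorem isSPS_of_mem_sparseAffOrbits {n s d : ℕ} {f : MvPolynomial (Fin n) K}
    (hf : f ∈ sparseAffOrbits (K := K) n s d) : IsSPS s (d + 1) f ∧ f.totalDegree ≤ d := by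
  obtain ⟨k, g, hs, hd, h, A, b, -, rfl⟩ := hf
  refine ⟨?_, (totalDegree_affSubst_le h A b g).trans hd⟩
  let β : Fin k → Option (Fin n) → K :=
    fun i o => o.elim (b (Fin.castLE h i)) fun l => A (Fin.castLE h i) l
  have hβ : (fun i : Fin k => (∑ j : Fin n, C (A (Fin.castLE h i) j) * X j) + C (b (Fin.castLE h i))) =
      fun i => C (β i none) + ∑ l : Fin n, C (β i (some l)) * X l := by
    funext i
    simp only [β, Option.elim]
    rw [add_comm]
  have key := isSPS_aeval_affine g hs hd β
  rw [← hβ] at key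
  exact key

/-- **Hitting set for `(s-sparse, deg ≤ d)∘affine` on a grid** (coefficient cover through
`Σ^{[s]}Π^{[d+1]}Σ`): for a nonempty grid `S ⊆ F` with `|S| ≥ 2d`, some `H ⊆ Sⁿ` with
`|H| ≤ s·((d+1)·(n+1))·(log₂(|S|ⁿ·(d+1) + 1) + 1) + 1` hits every nonzero member of
`sparseAffOrbits n s d`. [cite: MediniShpilka2021, Cor 44 (CCC p.19:14; existence and size)] -/
theorem exists_hittingSet_sparseAffOrbits_grid (n s d : ℕ) (S : Finset K) (hS1 : S.Nonempty)
    (hS : 2 * d ≤ S.card) :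
    ∃ H : Finset (Fin n → K), (∀ a ∈ H, ∀ i, a i ∈ S) ∧
      H.card ≤ s * ((d + 1) * (n + 1)) * (Nat.log 2 (S.card ^ n * (d + 1) + 1) + 1) + 1 ∧
      IsHittingSetFor (↑H : Set (Fin n → K)) (sparseAffOrbits (K := K) n s d) := by
  obtain ⟨H, hHS, hHcard, hhit⟩ := exists_hittingSet_isSPS (K := K) n s (d + 1) d S hS1 hS
  refine ⟨H, hHS, hHcard, fun f hf hf0 => ?_⟩
  obtain ⟨hsps, hdeg⟩ := isSPS_of_mem_sparseAffOrbits hf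
  obtain ⟨a, ha, hfa⟩ := hhit f hsps hdeg hf0
  exact ⟨a, Finset.mem_coe.mpr ha, hfa⟩

end SPSCoeff

end MS2021

end Literature.Computability.AlgebraicComplexity

end
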